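import Summits.RiemannHypothesis.RiemannHypothesis.Theorems.SignConeSignConeOscillatorySignedMajorantLemmas
import Literature.NumberTheory.LFunctions.WeilGroundEnergyProofs
import Literature.NumberTheory.LFunctions.WeilArchimedeanPositivityProofs

/-!
# The negative polar mass tolerated by the far-field bookkeeping — every cutoff, any negativity pattern
(route `SignCone`, item stmt-RiemannHypothesis-16302 `SignConeOscillatory`; HELPER file, `--supports`)

The prime-free bookkeeping of `SignConeFarField.farFieldMajorant` proves the unit-slack sign-cone inequality
`−Re F(0) ≤ Re W_ar(F)` for far-field-NONNEGATIVE tests with the certified margin `0.19·Re F(0)`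
(`farField_numerics_margin`). This file records the exact amount of far-field NEGATIVITY that margin pays for, with no
assumption on where the negativity sits (many gaps, any height, any cutoff):

* `re_weilArchPolar_ge_sub_negativeMass` — for every Weil test `F` with `|Re F| ≤ A = Re F(0)`,
  `Re W_ar(F) ≥ −A + (19/100)·A − ∫_{x > log 2} s⁻(x)·(e^{x/2} + e^{−x/2}) dx`,
  `s(x) = Re F(x) + Re F(−x)`, `s⁻ = max(0, −s)` (the NEGATIVE POLAR MASS of `F`; the weight is `2 cosh(x/2) ≥` Bombieri's `w`);
* `neg_re_zero_le_re_weilArchPolar_of_negativeMass_le` — hence the inequality holds as soon as the negative polar mass is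
  `≤ (19/100)·A`; `signConeOscillatory_of_negativeMass_le` is the version for autocorrelation sums `F = Σᵢ gᵢ ⋆ g̃ᵢ`
  (`|Re F| ≤ Re F(0)` by Bombieri's Lemma 2), at every cutoff, node hypothesis unused.

Reading. Uniform depth `δ·A` over the whole far field `[log 2, 2a]` has mass `≈ 8δA sinh a`, so the tolerance is
`δ ≲ 0.024/sinh a` (the number quoted in the route notes); a dip of depth `A` is tolerated on a set of `2cosh(x/2)dx`-measure
`0.19`, e.g. one node gap above `n ≈ 110` — versus `n ≥ 12` once the positive-definiteness lever of
`SignConeSignConeOscillatoryShortExcursion` is added. Everything beyond this mass budget is where node signs and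
positive-definiteness must do the work (`SignConeOscillatory.Negative.WithoutNodeNonneg`, `…WithoutPD`).
-/

noncomputable section

-- `Summit.RiemannHypothesis.RiemannHypothesis.…` repeats a namespace component by design (D-0017 layout).
set_option linter.dupNamespace false

open scoped BigOperators ComplexConjugate
open Complex MeasureTheory Set Filter

namespace Summit.RiemannHypothesis.RiemannHypothesis.Theorems.SignCone

open Literature.NumberTheory.LFunctions
open Summit.RiemannHypothesis.RiemannHypothesis.Theorems.SignConeFarField

/-! ## Splitting `∫_{(0,∞)} h` into five pieces with a function-valued far-field loss -/

/-- Splitting `∫_{(a,∞)} = ∫_{(a,b]} + ∫_{(b,∞)}` for `h` integrable on `(0, ∞)`, `0 ≤ a ≤ b`. [folklore] -/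
private theorem integral_Ioi_split'' {h : ℝ → ℝ} {a b : ℝ} (ha : 0 ≤ a) (hab : a ≤ b)
    (hint : IntegrableOn h (Ioi 0)) :
    ∫ x in Ioi a, h x = (∫ x in Ioc a b, h x) + ∫ x in Ioi b, h x := by
  rw [← Ioc_union_Ioi_eq_Ioi hab, setIntegral_union (Ioc_disjoint_Ioi le_rfl) measurableSet_Ioi
    (hint.mono_set (Ioc_subset_Ioi_self.trans (Ioi_subset_Ioi ha)))
    (hint.mono_set (Ioi_subset_Ioi (ha.trans hab)))]

/-- A constant minorant `c ≤ h` on `(a, b]` gives `c·(b − a) ≤ ∫_{(a,b]} h`. [folklore] -/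
private theorem const_piece'' {h : ℝ → ℝ} {a b c : ℝ} (ha : 0 ≤ a) (hab : a ≤ b)
    (hint : IntegrableOn h (Ioi 0)) (hle : ∀ x, a < x → x ≤ b → c ≤ h x) :
    c * (b - a) ≤ ∫ x in Ioc a b, h x := by
  have hI : IntegrableOn h (Ioc a b) :=
    hint.mono_set (Ioc_subset_Ioi_self.trans (Ioi_subset_Ioi ha))
  have h1 : ∫ _ in Ioc a b, c = c * (b - a) := by
    rw [setIntegral_const, Real.volume_real_Ioc_of_le hab, smul_eq_mul, mul_comm]
  rw [← h1]
  exact setIntegral_mono_on (integrableOn_const (by rw [Real.volume_Ioc]; exact ENNReal.ofReal_ne_top))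
    hI measurableSet_Ioc (fun x hx => hle x hx.1 hx.2)

/-- A continuous minorant `φ ≤ h` on `(a, b]` (`φ` continuous on `[a, b]`) gives `∫_a^b φ ≤ ∫_{(a,b]} h`. [folklore] -/
private theorem cont_piece'' {h φ : ℝ → ℝ} {a b : ℝ} (ha : 0 ≤ a) (hab : a ≤ b)
    (hint : IntegrableOn h (Ioi 0)) (hφ : ContinuousOn φ (Icc a b))
    (hle : ∀ x, a < x → x ≤ b → φ x ≤ h x) :
    (∫ x in a..b, φ x) ≤ ∫ x in Ioc a b, h x := by
  have hI : IntegrableOn h (Ioc a b) :=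
    hint.mono_set (Ioc_subset_Ioi_self.trans (Ioi_subset_Ioi ha))
  have hφI : IntegrableOn φ (Ioc a b) :=
    (hφ.integrableOn_Icc (μ := volume)).mono_set Ioc_subset_Icc_self
  rw [intervalIntegral.integral_of_le hab]
  exact setIntegral_mono_on hφI hI measurableSet_Ioc (fun x hx => hle x hx.1 hx.2)

/-- `1/sinh` is continuous on `[a, b]` for `a > 0`. [folklore] -/
private theorem continuousOn_one_div_sinh' {a b : ℝ} (ha : 0 < a) :
    ContinuousOn (fun x => 1 / Real.sinh x) (Icc a b) :=
  ContinuousOn.div₀ continuousOn_const Real.continuous_sinh.continuousOn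
    fun _ hx => (Real.sinh_pos_iff.2 (ha.trans_le hx.1)).ne'

/-- **The split with a far-field loss function.** For `A ≥ 0`, `h` integrable on `(0,∞)`, a loss function `n` continuous
on `[log 2, R]` (`log 2001 ≤ R`), the landed minorants on `(0,t₁]`, `[t₁,t₂]`, `[t₂,∞)` and, in the far field,
`A/sinh x − n(x) ≤ h x` on `[log 2, R]` and `A/sinh x ≤ h x` beyond `R`:
`A·(97/28 t₁ + 2.79(t₂−t₁) + ∫_{t₂}^{log 2} φ₃ + ∫_{log 2}^{log 2001} dx/sinh x) − ∫_{log 2}^{R} n ≤ ∫_{(0,∞)} h`. [folklore] -/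
theorem lossFunction_split (A : ℝ) (h n : ℝ → ℝ) (R : ℝ) (hA : 0 ≤ A) (hint : IntegrableOn h (Set.Ioi 0))
    (hR : Real.log 2001 ≤ R) (hn : ContinuousOn n (Icc (Real.log 2) R))
    (h1 : ∀ x, 0 < x → x ≤ 4 * Real.log (15 / 14) → A * (97 / 28) ≤ h x)
    (h2 : ∀ x, 4 * Real.log (15 / 14) ≤ x → x ≤ 2 * Real.log (7 / 6) → A * (279 / 100) ≤ h x)
    (h3 : ∀ x, 2 * Real.log (7 / 6) ≤ x →
      A * (Real.exp (x / 2) / (Real.exp (x / 2) - 1) - 36 / 85 * (Real.exp (x / 2) * (Real.exp (x / 2) - 1)) -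
        2 * Real.exp (x / 2) - 2 * Real.exp (-(x / 2))) ≤ h x)
    (h4 : ∀ x, Real.log 2 ≤ x → x ≤ R → A / Real.sinh x - n x ≤ h x)
    (h4' : ∀ x, R < x → A / Real.sinh x ≤ h x) :
    A * (97 / 28 * (4 * Real.log (15 / 14)) + 279 / 100 * (2 * Real.log (7 / 6) - 4 * Real.log (15 / 14)) +
        (∫ x in (2 * Real.log (7 / 6))..Real.log 2,
          (Real.exp (x / 2) / (Real.exp (x / 2) - 1) - 36 / 85 * (Real.exp (x / 2) * (Real.exp (x / 2) - 1)) -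
            2 * Real.exp (x / 2) - 2 * Real.exp (-(x / 2)))) +
        ∫ x in Real.log 2..Real.log 2001, 1 / Real.sinh x) -
      (∫ x in Real.log 2..R, n x) ≤ ∫ x in Set.Ioi (0 : ℝ), h x := by
  set t₁ : ℝ := 4 * Real.log (15 / 14) with ht₁_def
  set t₂ : ℝ := 2 * Real.log (7 / 6) with ht₂_def
  set L : ℝ := Real.log 2 with hL_def
  have ht₁ : 0 < t₁ := by
    have := Real.log_pos (by norm_num : (1 : ℝ) < 15 / 14)
    rw [ht₁_def]; linarith
  have e₁ : t₁ = Real.log ((15 / 14) ^ 4) := by rw [ht₁_def, Real.log_pow]; norm_num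
  have e₂ : t₂ = Real.log ((7 / 6) ^ 2) := by rw [ht₂_def, Real.log_pow]; norm_num
  have h₁₂ : t₁ ≤ t₂ := by rw [e₁, e₂]; exact Real.log_le_log (by norm_num) (by norm_num)
  have h₂L : t₂ ≤ L := by rw [e₂, hL_def]; exact Real.log_le_log (by norm_num) (by norm_num)
  have hL : 0 < L := Real.log_pos (by norm_num)
  have ht₂ : 0 < t₂ := ht₁.trans_le h₁₂
  have hLT : L ≤ Real.log 2001 := Real.log_le_log (by norm_num) (by norm_num)
  have hLR : L ≤ R := hLT.trans hR
  rw [integral_Ioi_split'' le_rfl ht₁.le hint, integral_Ioi_split'' ht₁.le h₁₂ hint,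
    integral_Ioi_split'' ht₂.le h₂L hint, integral_Ioi_split'' hL.le hLR hint]
  have p1 := const_piece'' le_rfl ht₁.le hint h1
  have p2 := const_piece'' ht₁.le h₁₂ hint (fun x hx hx' => h2 x hx.le hx')
  have p3 : (∫ x in t₂..L,
      A * (Real.exp (x / 2) / (Real.exp (x / 2) - 1) - 36 / 85 * (Real.exp (x / 2) * (Real.exp (x / 2) - 1)) -
        2 * Real.exp (x / 2) - 2 * Real.exp (-(x / 2)))) ≤ ∫ x in Ioc t₂ L, h x := by
    refine cont_piece'' ht₂.le h₂L hint ?_ (fun x hx _ => h3 x hx.le)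
    intro x hx
    have hx0 : Real.exp (x / 2) - 1 ≠ 0 := by
      have : 1 < Real.exp (x / 2) := Real.one_lt_exp_iff.2 (by linarith [hx.1])
      exact (sub_pos.2 this).ne'
    refine ContinuousAt.continuousWithinAt ?_
    fun_prop (disch := exact hx0)
  have p3e : (∫ x in t₂..L,
      A * (Real.exp (x / 2) / (Real.exp (x / 2) - 1) - 36 / 85 * (Real.exp (x / 2) * (Real.exp (x / 2) - 1)) -
        2 * Real.exp (x / 2) - 2 * Real.exp (-(x / 2)))) =
      A * ∫ x in t₂..L, (Real.exp (x / 2) / (Real.exp (x / 2) - 1) - 36 / 85 * (Real.exp (x / 2) * (Real.exp (x / 2) - 1)) -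
        2 * Real.exp (x / 2) - 2 * Real.exp (-(x / 2))) := intervalIntegral.integral_const_mul _ _
  have hsinhI : IntervalIntegrable (fun x => 1 / Real.sinh x) volume L R := by
    refine ContinuousOn.intervalIntegrable ?_
    rw [uIcc_of_le hLR]
    exact continuousOn_one_div_sinh' hL
  have hnI : IntervalIntegrable n volume L R := by
    refine ContinuousOn.intervalIntegrable ?_
    rw [uIcc_of_le hLR]
    exact hn
  have p4 : (∫ x in L..R, (A * (1 / Real.sinh x) - n x)) ≤ ∫ x in Ioc L R, h x := by
    refine cont_piece'' hL.le hLR hint ((continuousOn_const.mul (continuousOn_one_div_sinh' hL)).sub hn)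
      (fun x hx hx' => ?_)
    rw [mul_one_div]
    exact h4 x hx.le hx'
  have p4e : (∫ x in L..R, (A * (1 / Real.sinh x) - n x)) = A * (∫ x in L..R, 1 / Real.sinh x) - ∫ x in L..R, n x := by
    rw [intervalIntegral.integral_sub (hsinhI.const_mul A) hnI, intervalIntegral.integral_const_mul]
  have p5 : 0 ≤ ∫ x in Ioi R, h x := by
    refine setIntegral_nonneg measurableSet_Ioi (fun x hx => ?_)
    have hx : R < x := hx
    have hs : 0 < Real.sinh x := Real.sinh_pos_iff.2 (by linarith)
    exact (div_nonneg hA hs.le).trans (h4' x hx)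
  have imono : (∫ x in L..Real.log 2001, 1 / Real.sinh x) ≤ ∫ x in L..R, 1 / Real.sinh x := by
    have hI1 : IntervalIntegrable (fun x => 1 / Real.sinh x) volume L (Real.log 2001) := by
      refine ContinuousOn.intervalIntegrable ?_
      rw [uIcc_of_le hLT]
      exact continuousOn_one_div_sinh' hL
    have hI2 : IntervalIntegrable (fun x => 1 / Real.sinh x) volume (Real.log 2001) R := by
      refine ContinuousOn.intervalIntegrable ?_
      rw [uIcc_of_le hR]
      exact continuousOn_one_div_sinh' (hL.trans_le hLT)
    rw [← intervalIntegral.integral_add_adjacent_intervals hI1 hI2]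
    have : 0 ≤ ∫ x in Real.log 2001..R, 1 / Real.sinh x := by
      refine intervalIntegral.integral_nonneg hR (fun x hx => ?_)
      have hs : 0 < Real.sinh x := Real.sinh_pos_iff.2 ((hL.trans_le hLT).trans_le hx.1)
      positivity
    linarith
  have hfar : A * (∫ x in L..Real.log 2001, 1 / Real.sinh x) ≤ A * ∫ x in L..R, 1 / Real.sinh x :=
    mul_le_mul_of_nonneg_left imono hA
  rw [p3e] at p3
  rw [p4e] at p4
  nlinarith [p1, p2, p3, p4, p5, hfar]

/-! ## The negative polar mass bound -/

/-- **`Re W_ar(F) ≥ −0.81·A − (negative polar mass)`.** For a Weil test `F` with `|Re F(t)| ≤ A = Re F(0)` vanishing for `|x| > R`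
(any `R`; only used to make the loss integral proper), with `s(x) = Re F(x) + Re F(−x)`:
`−A + (19/100)·A − ∫_{log 2}^{max R (log 2001)} max(0, −s(x))·(e^{x/2} + e^{−x/2}) dx ≤ Re (weilPolarTerm F + weilArchTerm F)`.
No node hypothesis, no confinement, no positive-definiteness beyond `|Re F| ≤ A`. -/
theorem re_weilArchPolar_ge_sub_negativeMass (F : ℝ → ℂ) (hF : IsWeilTest F) {R : ℝ}
    (hbd : ∀ t : ℝ, |(F t).re| ≤ (F 0).re) (hzeroR : ∀ x : ℝ, R < |x| → F x = 0) :
    -(F 0).re + (19 / 100 * (F 0).re -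
        ∫ x in Real.log 2..max R (Real.log 2001),
          max 0 (-((F x).re + (F (-x)).re)) * (Real.exp (x / 2) + Real.exp (-(x / 2)))) ≤
      (weilPolarTerm F + weilArchTerm F).re := by
  obtain ⟨hint, hform⟩ := stub_bombieriReal F hF
  set A : ℝ := (F 0).re with hA_def
  set h : ℝ → ℝ := fun x : ℝ => ((F x).re + (F (-x)).re) * (Real.exp (-(x / 2)) + Real.exp (x / 2)) -
    (Real.exp (x / 2) * ((F x).re + (F (-x)).re) - 2 * A) / (2 * Real.sinh x) with hh_def
  set n : ℝ → ℝ := fun x : ℝ => max 0 (-((F x).re + (F (-x)).re)) * (Real.exp (x / 2) + Real.exp (-(x / 2))) with hn_def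
  set Y : ℝ := max R (Real.log 2001) with hY_def
  have hA : 0 ≤ A := le_trans (abs_nonneg _) (hbd 0)
  have hs_le : ∀ x : ℝ, (F x).re + (F (-x)).re ≤ 2 * A := fun x => by
    have h1 := (abs_le.1 (hbd x)).2
    have h2 := (abs_le.1 (hbd (-x))).2
    linarith
  have hs_ge : ∀ x : ℝ, -(2 * A) ≤ (F x).re + (F (-x)).re := fun x => by
    have h1 := (abs_le.1 (hbd x)).1
    have h2 := (abs_le.1 (hbd (-x))).1
    linarith
  have hs_abs : ∀ x : ℝ, |(F x).re + (F (-x)).re| ≤ 2 * A := fun x => abs_le.2 ⟨hs_ge x, hs_le x⟩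
  have hcontF : Continuous fun t : ℝ => (F t).re := Complex.continuous_re.comp hF.1.continuous
  have hcont_s : Continuous fun x : ℝ => (F x).re + (F (-x)).re := hcontF.add (hcontF.comp continuous_neg)
  have hn_cont : Continuous n := by
    rw [hn_def]
    exact (continuous_const.max hcont_s.neg).mul (by fun_prop)
  -- beyond the support `F = 0`
  have hzero : ∀ x : ℝ, R < x → F x = 0 ∧ F (-x) = 0 := by
    intro x hx
    have hx' : R < |x| := hx.trans_le (le_abs_self x)
    exact ⟨hzeroR x hx', hzeroR (-x) (by rwa [abs_neg])⟩
  have h1 : ∀ x, 0 < x → x ≤ 4 * Real.log (15 / 14) → A * (97 / 28) ≤ h x :=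
    fun x hx hx1 => stub_regionOneTwo.1 A _ x hA (hs_le x) hx hx1
  have h2 : ∀ x, 4 * Real.log (15 / 14) ≤ x → x ≤ 2 * Real.log (7 / 6) → A * (279 / 100) ≤ h x :=
    fun x hx hx1 => stub_regionOneTwo.2 A _ x hA (hs_abs x) hx hx1
  have h3 : ∀ x, 2 * Real.log (7 / 6) ≤ x →
      A * (Real.exp (x / 2) / (Real.exp (x / 2) - 1) - 36 / 85 * (Real.exp (x / 2) * (Real.exp (x / 2) - 1)) -
        2 * Real.exp (x / 2) - 2 * Real.exp (-(x / 2))) ≤ h x :=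
    fun x hx => stub_regionThreeFour.1 A _ x hA (hs_ge x) hx
  have h4 : ∀ x, Real.log 2 ≤ x → x ≤ Y → A / Real.sinh x - n x ≤ h x := by
    intro x hx _
    -- `regionFour_signed` with the pointwise depth `D = max(0, −s)/2`
    have hD : 0 ≤ max 0 (-((F x).re + (F (-x)).re)) / 2 := by positivity
    have hσ : -(2 * (max 0 (-((F x).re + (F (-x)).re)) / 2)) ≤ (F x).re + (F (-x)).re := by
      have := le_max_right 0 (-((F x).re + (F (-x)).re))
      linarith
    have h := regionFour_signed A (max 0 (-((F x).re + (F (-x)).re)) / 2) _ x hA hD hσ hx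
    have e : 2 * (max 0 (-((F x).re + (F (-x)).re)) / 2) * (Real.exp (x / 2) + Real.exp (-(x / 2))) = n x := by
      rw [hn_def]; ring
    rw [e] at h
    exact h
  have h4' : ∀ x, Y < x → A / Real.sinh x ≤ h x := by
    intro x hx
    have hxR : R < x := lt_of_le_of_lt (le_max_left _ _) hx
    have hxL : Real.log 2 ≤ x := by
      have : Real.log 2001 < x := lt_of_le_of_lt (le_max_right _ _) hx
      have hLT : Real.log 2 ≤ Real.log 2001 := Real.log_le_log (by norm_num) (by norm_num)
      linarith
    obtain ⟨z1, z2⟩ := hzero x hxR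
    refine stub_regionThreeFour.2 A _ x hA ?_ hxL
    rw [z1, z2]
    simp
  have hsplit := lossFunction_split A h n Y hA hint (le_max_right _ _) hn_cont.continuousOn h1 h2 h3 h4 h4'
  have hI3 := stub_intThree
  have hI4 := stub_intFour
  have hnum := farField_numerics_margin
  have key : (Real.log (4 * Real.pi) + Real.eulerMascheroniConstant - 1 + 19 / 100) * A -
      (∫ x in Real.log 2..Y, n x) ≤ ∫ x in Set.Ioi (0 : ℝ), h x := by
    refine le_trans ?_ hsplit
    have : (Real.log (4 * Real.pi) + Real.eulerMascheroniConstant - 1 + 19 / 100) * A ≤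
        A * (97 / 28 * (4 * Real.log (15 / 14)) + 279 / 100 * (2 * Real.log (7 / 6) - 4 * Real.log (15 / 14)) +
          (∫ x in (2 * Real.log (7 / 6))..Real.log 2,
            (Real.exp (x / 2) / (Real.exp (x / 2) - 1) - 36 / 85 * (Real.exp (x / 2) * (Real.exp (x / 2) - 1)) -
              2 * Real.exp (x / 2) - 2 * Real.exp (-(x / 2)))) +
          ∫ x in Real.log 2..Real.log 2001, 1 / Real.sinh x) := by
      rw [mul_comm]
      exact mul_le_mul_of_nonneg_left (by linarith) hA
    linarith
  rw [hform]
  linarith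

/-- **Small negative polar mass ⇒ the unit-slack inequality** (single Weil test). [folklore] -/
theorem neg_re_zero_le_re_weilArchPolar_of_negativeMass_le (F : ℝ → ℂ) (hF : IsWeilTest F) {R : ℝ}
    (hbd : ∀ t : ℝ, |(F t).re| ≤ (F 0).re) (hzeroR : ∀ x : ℝ, R < |x| → F x = 0)
    (hmass : ∫ x in Real.log 2..max R (Real.log 2001),
        max 0 (-((F x).re + (F (-x)).re)) * (Real.exp (x / 2) + Real.exp (-(x / 2))) ≤ 19 / 100 * (F 0).re) :
    -(F 0).re ≤ (weilPolarTerm F + weilArchTerm F).re := by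
  have h := re_weilArchPolar_ge_sub_negativeMass F hF hbd hzeroR
  linarith

/-- Bombieri's Lemma 2 summed: `|Re F(t)| ≤ Re F(0)` for `F = Σᵢ gᵢ ⋆ g̃ᵢ`. [folklore] -/
theorem abs_re_autocorrSum_le' {k : ℕ} {g : Fin k → ℝ → ℂ} {F : ℝ → ℂ}
    (hF : F = fun t => ∑ i, weilConv (g i) (weilReflect (g i)) t) (hg : ∀ i, IsWeilTest (g i)) (t : ℝ) :
    |(F t).re| ≤ (F 0).re := by
  have h0 : (F 0).re = ∑ i, ∫ u, ‖g i u‖ ^ 2 := by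
    rw [hF]
    simp only [Complex.re_sum, weilConv_weilReflect_apply_zero, Complex.ofReal_re]
  calc |(F t).re| ≤ ‖F t‖ := Complex.abs_re_le_norm _
    _ = ‖∑ i, weilConv (g i) (weilReflect (g i)) t‖ := by rw [hF]
    _ ≤ ∑ i, ‖weilConv (g i) (weilReflect (g i)) t‖ := norm_sum_le _ _
    _ ≤ ∑ i, ∫ u, ‖g i u‖ ^ 2 := Finset.sum_le_sum fun i _ => norm_weilConv_weilReflect_le (hg i) t
    _ = (F 0).re := h0.symm

/-- **Small negative polar mass ⇒ `SignConeOscillatory`'s inequality, every cutoff** (autocorrelation sums). For Weil tests `gᵢ`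
supported in `[−a, a]` and `F = Σᵢ gᵢ ⋆ g̃ᵢ` (so `F = 0` on `|t| ≥ 2a`): if the negative polar mass
`∫_{log 2}^{max 2a (log 2001)} max(0, −(Re F(x) + Re F(−x)))·(e^{x/2} + e^{−x/2}) dx` is at most `0.19·Re F(0)`, then
`−Re F(0) ≤ Re W_ar(F)`. [folklore] -/
theorem signConeOscillatory_of_negativeMass_le {k : ℕ} {g : Fin k → ℝ → ℂ} {F : ℝ → ℂ} {a : ℝ}
    (hF : F = fun t => ∑ i, weilConv (g i) (weilReflect (g i)) t) (hg : ∀ i, IsWeilTest (g i))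
    (hsupp : ∀ i, tsupport (g i) ⊆ Icc (-a) a)
    (hmass : ∫ x in Real.log 2..max (2 * a) (Real.log 2001),
        max 0 (-((F x).re + (F (-x)).re)) * (Real.exp (x / 2) + Real.exp (-(x / 2))) ≤ 19 / 100 * (F 0).re) :
    -(F 0).re ≤ (weilPolarTerm F + weilArchTerm F).re := by
  have hFt : IsWeilTest F := by
    rw [hF]; exact SignConeFarField.isWeilTest_sum _ fun i _ => (hg i).weilConv (hg i).weilReflect
  have hbd := abs_re_autocorrSum_le' hF hg
  have hzeroR : ∀ x : ℝ, 2 * a < |x| → F x = 0 := by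
    intro x hx
    rw [hF]
    exact Finset.sum_eq_zero fun i _ => weilConv_weilReflect_eq_zero_of_le_abs (hg i) (hsupp i) hx.le
  exact neg_re_zero_le_re_weilArchPolar_of_negativeMass_le F hFt hbd hzeroR hmass

/-- **Registered form of the negative-mass bound** (sub-goal `stub_negativeMass` of item stmt-RiemannHypothesis-16302). -/
theorem stub_negativeMass : ∀ (F : ℝ → ℂ), IsWeilTest F → ∀ R : ℝ, (∀ t : ℝ, |(F t).re| ≤ (F 0).re) → (∀ x : ℝ, R < |x| → F x = 0) → -(F 0).re + (19 / 100 * (F 0).re - ∫ x in Real.log 2..max R (Real.log 2001), max 0 (-((F x).re + (F (-x)).re)) * (Real.exp (x / 2) + Real.exp (-(x / 2)))) ≤ (weilPolarTerm F + weilArchTerm F).re :=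
  fun F hF _ hbd hzeroR => re_weilArchPolar_ge_sub_negativeMass F hF hbd hzeroR

end Summit.RiemannHypothesis.RiemannHypothesis.Theorems.SignCone

end
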